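import Summits.MatrixMultiplication.MatrixMultiplication.Theorems.AbelianSTPPCensusShapeCertVQBounds

/-!
# Abelian STPP census — soundness of `ShapeCertVQ` (part 4c: the search; root segments)

Cell mm-stpp, rung F-M1; successor kernel item VQ-CERT in support of the closed crux item stmt-MatrixMultiplication-19191; seat
mm-stpp-vp-p2 (gen 1).  Verbatim after theory g6's `…ShapeCertVPSearch` (level floor `loLev`, order bound `Mtop = 489`, the
standing hypotheses `AboveQ` with the E3⁺ condition) plus the one new case of the node analysis — the E3⁺ kill in front of the beat
test (`AboveQ.false_of_killE`): `feasP_completeQ`, the search induction (`stepQ_sound`, `loopQ_sound`, `dfsQ_sound`),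
**`checkQ_sound`** (if `checkQ M = true`, `M ≤ 489`, then no family in the universe of order `M` satisfying `AdmM`, `AdmG` and
`AdmE` has integer gain above `10⁶·M`), and the ROOT SEGMENTS: `checkQ_of_rootSegs` assembles kernel evaluations of
`rootSegQ M i n` over consecutive segments covering the candidate list into `checkQ M = true`.
The bridge to `SieveAdmissibleVP ∧ E3pAdm → ¬ Beats (5/2)` is `…ShapeCertVQFinal`.
-/

set_option linter.dupNamespace false -- `MatrixMultiplication.MatrixMultiplication` (summit = problem, D-0017)
set_option autoImplicit false

namespace Summit.MatrixMultiplication.MatrixMultiplication.Theorems.ShapeCertVQ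

open ShapeCert ShapeCertVP Multiset

section feas
/-! ### The admissibility test accepts every admissible extension (after eng-2's `feasA_complete`) -/

variable {M : ℕ}

/-- **completeness of the admissibility test** -/
theorem feasP_completeQ {t : Sh} {fam : List Sh} {G : Multiset (ℕ × ℕ × ℕ)} (h : AboveQ M G (t :: fam))
    (hF : famT (t :: fam) = G) :
    feasP M ((aggOf M fam).push t) t (!fam.isEmpty) (aggOf M fam).mxV (aggOf M fam).mxP (t :: fam) = true := by
  subst hF
  have hz : famT (t :: fam) - famT (t :: fam) = 0 := tsub_self _
  have u1 := h.tail_wa; have u2 := h.tail_wb; have u3 := h.tail_wc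
  have p1 := h.tail_pab; have p2 := h.tail_pbc; have p3 := h.tail_pca
  rw [hz] at u1 u2 u3 p1 p2 p3
  simp only [Multiset.map_zero, Multiset.sum_zero, zero_add] at u1 u2 u3 p1 p2 p3
  obtain ⟨⟨q1, q2, q3⟩, -, h9, h14, hT⟩ := h.adm
  rw [← sab_eqQ h.wf] at q1; rw [← sbc_eqQ h.wf] at q2; rw [← sca_eqQ h.wf] at q3
  have htU : InUniv M t.tr := h.univ _ (tr_mem_famT (by simp))
  have h9a : ∀ l ∈ fam, t.mpp + l.V ≤ M ∧ l.mpp + t.V ≤ M := by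
    intro l hl
    have hlF : l.tr ∈ famT (t :: fam) := tr_mem_famT (List.mem_cons_of_mem _ hl)
    have htF : t.tr ∈ famT (t :: fam) := tr_mem_famT (by simp)
    have e1 : famT (t :: fam) = t.tr ::ₘ famT fam := rfl
    have m1 : l.tr ∈ (famT (t :: fam)).erase t.tr := by
      rw [e1, Multiset.erase_cons_head]; exact tr_mem_famT hl
    have m2 : t.tr ∈ (famT (t :: fam)).erase l.tr := by
      by_cases he : l.tr = t.tr
      · rw [he, e1, Multiset.erase_cons_head, ← he]; exact tr_mem_famT hl
      · rw [e1, Multiset.erase_cons_tail _ (Ne.symm he)] ; exact Multiset.mem_cons_self _ _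
    have a := h9 t.tr htF l.tr m1
    have b := h9 l.tr hlF t.tr m2
    have wt := h.wf t (by simp); have wl := h.wf l (List.mem_cons_of_mem _ hl)
    have em := congrArg Sh.mpp wt; have ev := congrArg Sh.V wt
    have em' := congrArg Sh.mpp wl; have ev' := congrArg Sh.V wl
    rw [shQ_mpp] at em em'; rw [shQ_V] at ev ev'
    constructor <;> omega
  have hT2 : ∀ l ∈ t :: fam, t2ok M (sab (t :: fam)) (sbc (t :: fam)) (sca (t :: fam)) l = true := by
    intro l hl
    have hlF : l.tr ∈ famT (t :: fam) := tr_mem_famT hl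
    obtain ⟨x1, x2, x3⟩ := hT l.tr hlF
    have s1 := h.erase_split hl pab; have s2 := h.erase_split hl pbc; have s3 := h.erase_split hl pca
    rw [hz] at s1 s2 s3
    simp only [Multiset.map_zero, Multiset.sum_zero, add_zero] at s1 s2 s3
    rw [← sab_eqQ h.wf] at s1; rw [← sbc_eqQ h.wf] at s2; rw [← sca_eqQ h.wf] at s3
    have hUl := h.univ _ hlF
    have v1 := hUl.pab_le_vol; have v2 := hUl.pbc_le_vol; have v3 := hUl.pca_le_vol
    have wl := h.wf l hl
    have eV := congrArg Sh.V wl; have eab := congrArg Sh.ab wl; have ebc := congrArg Sh.bc wl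
    have eca := congrArg Sh.ca wl; have ea := congrArg Sh.a wl; have eb := congrArg Sh.b wl
    have ec := congrArg Sh.c wl
    rw [shQ_V] at eV; rw [shQ_ab] at eab; rw [shQ_bc] at ebc; rw [shQ_ca] at eca
    rw [shQ_a] at ea; rw [shQ_b] at eb; rw [shQ_c] at ec
    apply t2ok_of
    · intro ha hb; rw [eV, ea, ec]; exact x1 (by omega) (by omega)
    · intro ha hb; rw [eV, eb, ea]; exact x2 (by omega) (by omega)
    · intro ha hb; rw [eV, ec, eb]; exact x3 (by omega) (by omega)
  have hmpp := htU.mpp_le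
  have hVt : t.V ≤ M := by
    have := htU.vol_le; have ev := congrArg Sh.V (h.wf t (by simp)); rw [shQ_V] at ev; omega
  have emt := congrArg Sh.mpp (h.wf t (by simp)); rw [shQ_mpp] at emt
  rw [← aggOf_cons]
  unfold feasP
  simp only [aggOf, Bool.and_eq_true, decide_eq_true_eq, Bool.or_eq_true, List.all_eq_true, Bool.not_not]
  refine ⟨⟨⟨⟨⟨⟨⟨⟨⟨⟨u1, u2⟩, u3⟩, q1⟩, q2⟩, q3⟩, by omega⟩, by omega⟩, by omega⟩, ?_⟩, hT2⟩
  by_cases he : fam = []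
  · left; simp [he]
  · right
    constructor
    · have : mxV fam ≤ M - t.mpp := mxV_le fun l hl => by have := (h9a l hl).1; omega
      omega
    · have : mxP fam ≤ M - t.V := mxP_le fun l hl => by have := (h9a l hl).2; omega
      omega

end feas

section search
/-! ### The search is sound -/

variable {M : ℕ}

/-- the tail of a good pool is good -/
theorem PoolOKQ.tail {R : List Sh} {t : Sh} (h : PoolOKQ M (t :: R)) : PoolOKQ M R :=
  ⟨fun s hs => h.wf s (List.mem_cons_of_mem _ hs), fun s hs => h.univ s (List.mem_cons_of_mem _ hs),
    (List.pairwise_cons.mp h.sorted).2⟩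

/-- **Soundness of one candidate step.**  If `stepQ` accepts candidate `t` (a tail member of the family) then the
family does not beat — given the induction hypothesis for the recursive search. -/
theorem stepQ_sound {rec : List Sh → List Sh → Bool} {t : Sh} {fam rest : List Sh}
    (IH : ∀ fam' R', WfQ M fam' → PoolOKQ M R' → (fam' ≠ [] → ∀ s ∈ R', s.lev ≤ headLevQ fam') →
      rec fam' R' = true → GoalQ M fam' R')
    (hwf : WfQ M fam) (hP : PoolOKQ M (t :: rest))
    (hstep : stepQ M rec t (aggOf M fam) fam ((aggOf M fam).gs * K) ((aggOf M fam).q0 M)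
      (selOf ((aggOf M fam).kOf M)) (M * D * K) rest = true)
    {G : Multiset (ℕ × ℕ × ℕ)} (hG : AboveQ M G fam) (hbeat : M * D < gsumQ G)
    (hpool : ∀ x ∈ G - famT fam, levTQ x ≤ loLev ∨ shQ M x ∈ t :: rest) (hx : t.tr ∈ G - famT fam) : False := by
  have hwt : t = shQ M t.tr := hP.wf t (by simp)
  -- every tail member has level ≤ 27 or ≤ t.lev
  have hL : ∀ x ∈ G - famT fam, levTQ x ≤ loLev ∨ levTQ x ≤ t.lev := by
    intro x hx'
    rcases hpool x hx' with h | h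
    · exact Or.inl h
    · right
      rcases List.mem_cons.mp h with h | h
      · rw [← shQ_lev M x, h]
      · have := List.rel_of_pairwise_cons hP.sorted h
        rw [← shQ_lev M x]; exact this
  unfold stepQ at hstep
  rw [aggOf_gs] at hstep
  by_cases hpre : gs fam * K + t.g * K + selOf ((aggOf M fam).kOf M) (tabRQ t.lev) *
      min ((aggOf M fam).q0 M) ((3 * M + (t.a + t.b + t.c)) / 2 - uuA (aggOf M fam) - (t.ab + t.bc + t.ca)) ≤
      M * D * K
  · exact hG.not_beat_of_first hx hwt hL hpre hbeat
  rw [if_neg hpre, Agg.force_eq] at hstep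
  -- the extended prefix
  have hwf1 : WfQ M (t :: fam) := by
    intro s hs; rcases List.mem_cons.mp hs with rfl | hs
    · exact hwt
    · exact hwf s hs
  have hle1 : famT (t :: fam) ≤ G := cons_le_of_mem_sub hG.le hx
  have hG1 : AboveQ M G (t :: fam) := ⟨hG.hM, hG.univ, hG.adm, hG.admG, hG.admE, hwf1, hle1⟩
  have hpool1 : ∀ x ∈ G - famT (t :: fam), levTQ x ≤ loLev ∨ shQ M x ∈ t :: rest :=
    fun x hx' => hpool x (Multiset.mem_of_le (sub_cons_le _ _ _) hx')
  have hL1 : ∀ x ∈ G - famT (t :: fam), levTQ x ≤ loLev ∨ levTQ x ≤ t.lev :=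
    fun x hx' => hL x (Multiset.mem_of_le (sub_cons_le _ _ _) hx')
  by_cases hpr : ((aggOf M fam).push t).prune M (tabRQ t.lev) = true
  · rw [← aggOf_cons] at hpr
    have hp := prune_sound hpr
    rw [aggOf_gs] at hp
    exact hG1.not_beat_of_R hL1 hp hbeat
  rw [if_neg hpr] at hstep
  -- admissibility of the extended prefix is recognised
  have hF : AboveQ M (famT (t :: fam)) (t :: fam) :=
    ⟨hG.hM, fun x hx' => hG.univ x (Multiset.mem_of_le hle1 hx'), hG.adm.mono hle1, hG.admG.mono hle1,
      hG.admE.mono hG.univ hle1, hwf1, le_rfl⟩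
  rw [feasP_completeQ hF rfl, if_pos rfl] at hstep
  by_cases hk : killV M ((aggOf M fam).push t) (t :: fam) = true
  · rw [← aggOf_cons] at hk
    exact not_admG_of_killVQ hwf1 hk (hG.admG.mono hle1)
  rw [if_neg hk] at hstep
  -- recursion
  exact IH (t :: fam) (t :: rest) hwf1 hP (fun _ s hs => by
    rcases List.mem_cons.mp hs with rfl | hs
    · exact le_rfl
    · exact List.rel_of_pairwise_cons hP.sorted hs) hstep G hG1 hbeat hpool1

/-- **Soundness of one level of the walk** (induction on the candidate list) -/
theorem loopQ_sound {rec : List Sh → List Sh → Bool} {fam : List Sh}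
    (IH : ∀ fam' R', WfQ M fam' → PoolOKQ M R' → (fam' ≠ [] → ∀ s ∈ R', s.lev ≤ headLevQ fam') →
      rec fam' R' = true → GoalQ M fam' R')
    (hwf : WfQ M fam) (hM : M ≤ 489) (hnb : ¬ M * D < (aggOf M fam).gs)
    {lb1 : ℕ} (hlb : lb1 ≠ 0 → loLev ≤ lb1 - 1 ∧
      ((aggOf M fam).gs * K + (aggOf M fam).bnd M (tabRQ (lb1 - 1)) ≤ M * D * K ∨
       ∃ i b, (budsOf M (aggOf M fam) fam).get i = some b ∧
         (aggOf M fam).gs * K + b * (tabGQ (lb1 - 1)).get i ≤ M * D * K))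
    {cl : Bool} (hcl : cl = true → fam = [] ∨ (aggOf M fam).gs * K + (aggOf M fam).bnd M (tabRQ loLev) ≤ M * D * K ∨
       ∃ i b, (budsOf M (aggOf M fam) fam).get i = some b ∧ (aggOf M fam).gs * K + b * (tabGQ loLev).get i ≤ M * D * K) :
    ∀ R : List Sh, PoolOKQ M R →
      loopQ M rec fam (aggOf M fam) ((aggOf M fam).ra M) ((aggOf M fam).rb M) ((aggOf M fam).rc M)
        ((aggOf M fam).vl M) ((aggOf M fam).gs * K) ((aggOf M fam).q0 M) (selOf ((aggOf M fam).kOf M)) (M * D * K)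
        lb1 cl R = true → GoalQ M fam R
  | [], _, hloop => by
    intro G hG hbeat hpool
    rw [loopQ] at hloop
    have hlow : ∀ x ∈ G - famT fam, levTQ x ≤ loLev := fun x hx => by
      rcases hpool x hx with h | h
      · exact h
      · simp at h
    rcases hcl hloop with h | h | ⟨i, b, hb, hle⟩
    · subst h
      have : G - famT [] = G := by simp [famT]
      rw [this] at hlow
      exact gsum_le_of_lowQ hM hG.univ hG.adm hlow hbeat
    · exact hG.not_beat_of_R (L := loLev) (fun x hx => Or.inl (hlow x hx)) (by simpa only [aggOf_gs] using h) hbeat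
    · exact hG.not_beat_of_G hb (L := loLev) (fun x hx => Or.inl (hlow x hx)) (by simpa only [aggOf_gs] using hle) hbeat
  | t :: R', hP, hloop => by
    intro G hG hbeat hpool
    rw [loopQ] at hloop
    -- break: every tail member has level ≤ t.lev ≤ lb1 - 1
    by_cases hbr : t.lev < lb1
    · obtain ⟨hlo, hb⟩ := hlb (by omega)
      have hL : ∀ x ∈ G - famT fam, levTQ x ≤ loLev ∨ levTQ x ≤ lb1 - 1 := by
        intro x hx
        rcases hpool x hx with h | h
        · exact Or.inl h
        · right
          have : (shQ M x).lev ≤ t.lev := by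
            rcases List.mem_cons.mp h with h | h
            · rw [h]
            · exact List.rel_of_pairwise_cons hP.sorted h
          rw [shQ_lev] at this; omega
      rcases hb with hb | ⟨i, b, hbi, hle⟩
      · exact hG.not_beat_of_R hL (by simpa only [aggOf_gs] using hb) hbeat
      · exact hG.not_beat_of_G hbi hL (by simpa only [aggOf_gs] using hle) hbeat
    rw [if_neg hbr] at hloop
    have hpool' : t.tr ∉ G - famT fam → ∀ x ∈ G - famT fam, levTQ x ≤ loLev ∨ shQ M x ∈ R' := by
      intro ht x hx
      rcases hpool x hx with h | h
      · exact Or.inl h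
      · rcases List.mem_cons.mp h with he | he
        · exfalso; apply ht; rw [← he, shQ_tr]; exact hx
        · exact Or.inr he
    by_cases hch : (aggOf M fam).ra M < t.wA ∨ (aggOf M fam).rb M < t.wB ∨ (aggOf M fam).rc M < t.wC ∨
        (aggOf M fam).vl M < t.V
    · -- cheap reject: `t` cannot be a tail member
      rw [if_pos hch] at hloop
      refine loopQ_sound IH hwf hM hnb hlb hcl R' hP.tail hloop G hG hbeat (hpool' fun hx => ?_)
      have hU := hG.univ _ (mem_G_of_tail hx)
      have w1 := Multiset.le_sum_of_mem (Multiset.mem_map_of_mem wa hx)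
      have w2 := Multiset.le_sum_of_mem (Multiset.mem_map_of_mem wb hx)
      have w3 := Multiset.le_sum_of_mem (Multiset.mem_map_of_mem wc hx)
      have t1 := hG.tail_wa; have t2 := hG.tail_wb; have t3 := hG.tail_wc
      obtain ⟨v1, v2, v3, v4⟩ := hG.tail_vol hx
      have wt := hP.wf t (by simp)
      have ea := congrArg Sh.wA wt; have eb := congrArg Sh.wB wt; have ec := congrArg Sh.wC wt
      have ev := congrArg Sh.V wt
      rw [shQ_wA] at ea; rw [shQ_wB] at eb; rw [shQ_wC] at ec; rw [shQ_V] at ev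
      unfold Agg.ra Agg.rb Agg.rc Agg.vl Agg.mc aggOf at hch; simp only at hch
      have hm : max (max (sab fam) (max (sbc fam) (sca fam))) (mxP fam) ≤ M - vol t.tr :=
        max_le (max_le (by omega) (max_le (by omega) (by omega))) (by omega)
      omega
    rw [if_neg hch, Bool.and_eq_true] at hloop
    obtain ⟨hstep, hrest⟩ := hloop
    by_cases hx : t.tr ∈ G - famT fam
    · exact stepQ_sound IH hwf hP hstep hG hbeat hpool hx
    · exact loopQ_sound IH hwf hM hnb hlb hcl R' hP.tail hrest G hG hbeat (hpool' hx)

/-- **Soundness of the search** (induction on the fuel) -/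
theorem dfsQ_sound (hM : M ≤ 489) : ∀ (n : ℕ) (fam R : List Sh), WfQ M fam → PoolOKQ M R →
    (fam ≠ [] → ∀ s ∈ R, s.lev ≤ headLevQ fam) → dfsQ M n fam R = true → GoalQ M fam R
  | 0, fam, R, _, _, _, h => by simp [dfsQ] at h
  | n + 1, fam, R, hwf, hP, hhead, h => by
    simp only [dfsQ, Agg.force_eq, seqN_eq] at h
    intro G hG hbeat hpool
    by_cases hk : killE M (aggOf M fam) fam = true
    · exact hG.false_of_killE hk
    rw [if_neg hk] at h
    by_cases hb : M * D < (aggOf M fam).gs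
    · rw [if_pos hb] at h; exact Bool.false_ne_true h
    rw [if_neg hb] at h
    by_cases hd : (aggOf M fam).dead M = true
    · have h0 := hG.tail_eq_zero_of_dead hd
      rw [hG.gsum_split, h0] at hbeat; simp [gsumQ] at hbeat; rw [aggOf_gs] at hb; omega
    rw [if_neg hd] at h
    -- levels of the tail are bounded by the node's own level (or the floor)
    have hL : fam ≠ [] → ∀ x ∈ G - famT fam, levTQ x ≤ loLev ∨ levTQ x ≤ headLevQ fam := by
      intro hf x hx
      rcases hpool x hx with h' | h'
      · exact Or.inl h'
      · right; rw [← shQ_lev M x]; exact hhead hf _ h'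
    by_cases hte : (budsOf M (aggOf M fam) fam).tailEmpty = true
    · rw [if_pos hte, decide_eq_true_eq] at h
      obtain ⟨i, b, hbi, hsmall⟩ := tailEmpty_spec hte
      exact hG.not_beat_of_empty hbi hsmall h hbeat
    rw [if_neg hte] at h
    set S := gnodeQ (headLevQ fam) (budsOf M (aggOf M fam) fam) with hS
    by_cases hg : (S.ok && decide ((aggOf M fam).gs * K + S.bud * (tabGQ (headLevQ fam)).get S.idx ≤ M * D * K)) =
        true
    · rw [Bool.and_eq_true, decide_eq_true_eq] at hg
      by_cases hf : fam = []
      · subst hf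
        rw [budsOf_nil] at hS
        have : S.ok = false := by rw [hS]; rfl
        rw [this] at hg; exact Bool.false_ne_true hg.1
      · have hsel := gnodeQ_spec (headLevQ fam) (budsOf M (aggOf M fam) fam) hg.1
        exact hG.not_beat_of_G hsel (hL hf) hg.2 hbeat
    rw [if_neg hg] at h
    generalize hlb : breakLevQ ((aggOf M fam).gs * K) ((aggOf M fam).q0 M) (selOf ((aggOf M fam).kOf M)) (M * D * K)
      S.ok S.bud S.idx = lb1 at h
    generalize hcl : ((fam.isEmpty || decide ((aggOf M fam).gs * K + selOf ((aggOf M fam).kOf M) (tabRQ loLev) *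
      (aggOf M fam).q0 M ≤ M * D * K)) || clAnyQ (budsOf M (aggOf M fam) fam) ((aggOf M fam).gs * K) (M * D * K) loLev)
      = cl at h
    refine loopQ_sound (fun fam' R' => dfsQ_sound hM n fam' R') hwf hM hb ?_ ?_ R hP h G hG hbeat hpool
    · -- the break level
      intro h0
      obtain ⟨hlo, hc⟩ := breakLevQ_spec hlb h0
      refine ⟨hlo, ?_⟩
      rcases hc with hc | ⟨hok, hc⟩
      · exact Or.inl (bnd_le_of_testQ hc)
      · exact Or.inr ⟨S.idx, S.bud, gnodeQ_spec _ _ hok, hc⟩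
    · -- the closure value
      intro hc
      rw [← hcl] at hc
      simp only [Bool.or_eq_true, decide_eq_true_eq] at hc
      rcases hc with (hc | hc) | hc
      · exact Or.inl (List.isEmpty_iff.mp hc)
      · exact Or.inr (Or.inl (bnd_le_of_testQ hc))
      · obtain ⟨i, b, hbi, hle⟩ := clAnyQ_spec hc
        exact Or.inr (Or.inr ⟨i, b, hbi, hle⟩)

/-- **Soundness of the checker.** If `checkQ M` succeeds (`M ≤ 489`), no shape multiset inside the universe that
satisfies the vM system, rule U11-G (credit form) and the E3⁺ condition has integer gain above `10⁶·M`. -/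
theorem checkQ_sound {M : ℕ} (h : checkQ M = true) (hM : M ≤ 489) (G : Multiset (ℕ × ℕ × ℕ))
    (hU : ∀ x ∈ G, InUniv M x) (hA : AdmM M G) (hG : AdmG M G) (hE : AdmE M G) : ¬ M * D < gsumQ G := by
  intro hbeat
  have hP : PoolOKQ M (candQ M) := ⟨candQ_wf M, candQ_inUniv M, candQ_sorted M⟩
  refine dfsQ_sound hM (M + 2) [] (candQ M) (fun _ h => by simp at h) hP (fun h => absurd rfl h) h G
    ⟨hM, hU, hA, hG, hE, fun _ h => by simp at h, by simp [famT]⟩ hbeat ?_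
  intro x hx
  have hxG : x ∈ G := Multiset.mem_of_le (Multiset.sub_le_self _ _) hx
  exact Or.inr (shQ_mem_candQ hM (hU x hxG))


/-! ### Root segments -/

/-- a root segment of length `n` followed by the plain walk of the rest gives the plain walk: if `rootLoopQ … n L = true` and
`loopQ … true (L.drop n) = true` then `loopQ … true L = true` -/
theorem loopQ_of_rootLoopQ {rec : List Sh → List Sh → Bool} {A : Agg} {ra rb rc vl g0 q : ℕ} {sel : B8 → ℕ}
    {mdk lb1 : ℕ} : ∀ (n : ℕ) (L : List Sh),
    rootLoopQ M rec A ra rb rc vl g0 q sel mdk lb1 n L = true →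
    loopQ M rec [] A ra rb rc vl g0 q sel mdk lb1 true (L.drop n) = true →
    loopQ M rec [] A ra rb rc vl g0 q sel mdk lb1 true L = true
  | n, [], _, _ => by cases n <;> rfl
  | 0, _ :: _, _, h => by simpa using h
  | n + 1, t :: rest, hr, hd => by
    rw [rootLoopQ] at hr
    rw [loopQ]
    by_cases hbr : t.lev < lb1
    · rw [if_pos hbr]
    · rw [if_neg hbr] at hr ⊢
      rw [List.drop_succ_cons] at hd
      by_cases hsk : ra < t.wA ∨ rb < t.wB ∨ rc < t.wC ∨ vl < t.V
      · rw [if_pos hsk] at hr ⊢; exact loopQ_of_rootLoopQ n rest hr hd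
      · rw [if_neg hsk] at hr ⊢
        rw [Bool.and_eq_true] at hr ⊢
        exact ⟨hr.1, loopQ_of_rootLoopQ n rest hr.2 hd⟩

/-- consecutive root segments compose: segments `[i, i+n)` and «everything from `i + n`» give «everything from `i`» -/
theorem rootSegQ_append {M i n : ℕ} (h1 : rootSegQ M i n = true)
    (h2 : loopQ M (dfsQ M (M + 1)) [] (aggOf M []) ((aggOf M []).ra M) ((aggOf M []).rb M) ((aggOf M []).rc M)
      ((aggOf M []).vl M) ((aggOf M []).gs * K) ((aggOf M []).q0 M) (selOf ((aggOf M []).kOf M)) (M * D * K)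
      (rootLb1 M) true ((candQ M).drop (i + n)) = true) :
    loopQ M (dfsQ M (M + 1)) [] (aggOf M []) ((aggOf M []).ra M) ((aggOf M []).rb M) ((aggOf M []).rc M)
      ((aggOf M []).vl M) ((aggOf M []).gs * K) ((aggOf M []).q0 M) (selOf ((aggOf M []).kOf M)) (M * D * K)
      (rootLb1 M) true ((candQ M).drop i) = true := by
  unfold rootSegQ at h1
  simp only [Agg.force_eq, seqN_eq] at h1
  rw [← List.drop_drop] at h2
  exact loopQ_of_rootLoopQ n _ h1 h2

/-- the root walk from position `i` is trivially true past the end of the candidate list -/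
theorem rootTail_nil {M i : ℕ} (hi : (candQ M).length ≤ i) :
    loopQ M (dfsQ M (M + 1)) [] (aggOf M []) ((aggOf M []).ra M) ((aggOf M []).rb M) ((aggOf M []).rc M)
      ((aggOf M []).vl M) ((aggOf M []).gs * K) ((aggOf M []).q0 M) (selOf ((aggOf M []).kOf M)) (M * D * K)
      (rootLb1 M) true ((candQ M).drop i) = true := by
  rw [List.drop_eq_nil_of_le hi]; rfl

/-- **root segments give the certificate**: if the root walk from position `0` passes then `checkQ M = true` -/
theorem checkQ_of_root {M : ℕ}
    (h : loopQ M (dfsQ M (M + 1)) [] (aggOf M []) ((aggOf M []).ra M) ((aggOf M []).rb M) ((aggOf M []).rc M)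
      ((aggOf M []).vl M) ((aggOf M []).gs * K) ((aggOf M []).q0 M) (selOf ((aggOf M []).kOf M)) (M * D * K)
      (rootLb1 M) true ((candQ M).drop 0) = true) :
    checkQ M = true := by
  rw [List.drop_zero] at h
  unfold checkQ
  rw [dfsQ]
  simp only [Agg.force_eq, seqN_eq]
  have hk : killE M (aggOf M []) [] = false := rfl
  have hb : ¬ M * D < (aggOf M []).gs := by show ¬ M * D < gs []; simp [gs]
  rw [hk, if_neg hb]
  simp only [Bool.false_eq_true, ↓reduceIte]
  by_cases hd : (aggOf M []).dead M = true
  · rw [if_pos hd]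
  rw [if_neg hd, budsOf_nil]
  have hte : (⟨none, none, none, none, none, none⟩ : Buds).tailEmpty = false := rfl
  rw [hte]
  simp only [Bool.false_eq_true, ↓reduceIte]
  have hg : gnodeQ (headLevQ []) ⟨none, none, none, none, none, none⟩ = ⟨false, 0, 0, 0⟩ := rfl
  rw [hg]
  simp only [Bool.false_and, Bool.false_eq_true, ↓reduceIte, List.isEmpty_nil, Bool.true_or]
  exact h

end search

end Summit.MatrixMultiplication.MatrixMultiplication.Theorems.ShapeCertVQ
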